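import Summits.ABC.IUTFork.Conditional.AbcOfSGenuineKTameRobustTriple
import Summits.ABC.IUTFork.Conditional.AbcOfSGenuineKChosenDepth
import Summits.ABC.IUTFork.Conditional.HexDepthArithmeticSharp
import Summits.ABC.IUTFork.Cor312SzpiroBadVsDepthExact
import Summits.ABC.ABC.Theorems.IUTThetaPilotThetaPartIIStubThetaData
import Literature.IUT.LogVolume.Corollary22RatPointDictionary
import Literature.IUT.LogVolume.Corollary22PartIIUpTo
import Literature.IUT.LogVolume.DepthConstantsTameBudget
import Mathlib.Analysis.Real.Pi.Bounds
import HarnessLib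

/-!
# R-W task «C:HSHW-REF» (tier 2/3), kit part 2: the hull-level clause S_H FAILS by EXPLICIT DEPTH at a TAME pole prime of a rational point —
# the [ED] route, with NO lattice-tameness input `e ≤ p − 2` (so also below abc-iut-w5-d107's prime floor `60·l + 2`)

PROOF-ONLY file (no `def`, no new `Prop`, no instance, no notation) of the abc-iut cell (seat abc-iut-W-ref-3, gen 0; R-W row «C:HSHW-REF
tier-2/3 (p = 167 [ED], p = 1061, p = 463)», abc-iut-w6-d102's second, files disjoint by prime). TAKES NO SIDE on [IUTchIII] Cor. 3.12 or on
any author. Everything here is COMPOSITION BY NAME of landed theorems; the per-prime files `AbcOfSHwindowFreyRefutation<p>.lean` instantiate it.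

The binder `hSHwBad` of the branch-C cut certificate of record `Conditional.abc_of_SH_v10K_window_szpiroBadAll` (abc-iut-s2-p2 p453137; parent
cuts abc-iut-c312-d1 p450130 / p449402) demands the hull-level clause S_H = `Cor312Vol.PilotKummerCompatHull` (CHOSEN realising ideles, PINNED
reading) at every genuine Θ-volume datum `T` over an ADMISSIBLE (`P ∈ U_P`, `l ≥ 5` prime, `AdmitsCore`, (P2), (P5), (P6)) and SZPIRO-BAD
`(P, l)` that is OFF the degree-form depth locus. A kernel refutation at a rational point `P = ratPoint λ` therefore needs, at ONE `(λ, l)`: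
(W) every datum over `(λ, l)` is off the depth locus; (G) the Szpiro-bad guard; (S) `¬ S_H` at every datum (for every choice of the free
context binders); (N) a datum exists — `ThetaPartII.stub_thetaData` (abc-iut-c312-8 / L5-t7) from admissibility, with (P6) = `Cor22.CondP6`
kept as a NAMED HYPOTHESIS (an existing definition; the image-of-Galois input is not decided in the tree at explicit points).

This part (S):
* `FreyRef.not_pilotKummerCompatHull_chosen_ratPoint_of_explicitDepth` / `…_triple_of_explicitDepth` — at a pole prime `p ∉ {2, 3, 5, l}`:
  abc-iut-W-neg-1's local type `e(K_{x₀}/ℚ_p) ∣ 60·l`, `p ∤ e` (`GenuineK.absRamificationIdx_kOf_dvd_ratPoint`, p459442) + abc-iut-S-d1's tame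
  budget `d + a + b < 1 + 1/(p−2) + k` once `p·60l < p^{k+1}(p−1)` (`depthConstants_lt_of_not_dvd_of_le`, p455792) + abc-iut-w4-d026's
  `‖t_q(x₀)‖ ≤ p^{−h/(2l)}` (`norm_chosenQIdele_le_rpow_of_ratPoint'`) + abc-iut-C-cert-1's per-label decider
  `GenuineK.not_pilotKummerCompatHull_chosen_of_explicit_depth` (p438886) + the analytic step `Hex.core_ineq_dab_label` (abc-iut-C-cert-1),
  under ONE integer test `2l·((i₀+2)((p−2)(k+1)+1) + (p−2)) < h·i₀(i₀+2)·(p−2)` at a label `i₀ + 1 ≤ l⋆` (triple form: `h = 2v`, `p^v ∣ abc`).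
  R-W reading: the «[ED]» column of WINDOW-TABLE / TARGETS.tsv at a tame place, as a theorem uniform in the datum.
Parts 1/3: `AbcOfSHwindowFreyRefutationWindow.lean` (window + guard), `AbcOfSHwindowFreyRefutationApex.lean` (the apex).

HONEST SCOPE (binding, abc-iut-w5-d107's framing adopted): SHARP reading; the per-label licence is a STRONGER-THAN-PRINT sufficient form of
(xi-f); nothing here bears on the printed GLOBAL inequality, the number-level Corollary (`Cor22.Cor312AtDatum`, the binder `hNumBad`), or any
author's intended hull; the θ-cut record (p460293) is untouched; (P6) at explicit points is ASSUMED, never proved here; «refuted as typed» ≠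
«refuted in print»; typed ≠ proved; instantiated ≠ endorsed; no abc claim. [cite: Mochizuki2012, IUTchIII Cor. 3.12 p. 173–174, Step (xi-f) p. 184;
IUTchIV Prop. 1.2 p. 10, Thm. 1.10 p. 22–23, Cor. 2.2 (ii) proof (P2)(P5)(P6)(P7) p. 45–46] [cite: MochizukiGenEll2010, Def. 3.3 p. 12]
[cite: DupuyHilado2025, §3.3, §3.4] [claim: Mochizuki2012, status: disputed] for every IUT sentence quoted.
-/

noncomputable section

open Set Function NumberField IsDedekindDomain

namespace Summit.ABC.IUTFork.Conditional

open Thm311 Thm311.Real Cor312 Cor312Vol Cor312Prov Literature.IUT.LogThetaLattice Literature.IUT.LogVolume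
  Literature.IUT.HodgeTheaters Literature.IUT.LogVolume.ThetaData Literature.IUT.LogVolume.Cor22
open Literature.NumberTheory.NumberFields Literature.NumberTheory.GaloisRepresentations.Ultrametric
open Literature.NumberTheory.DiophantineGeometry Literature.NumberTheory.DiophantineGeometry.GenEll Summit.ABC.ABC.Theorems

namespace FreyRef

/-! ## (S) The hull-level clause fails by EXPLICIT DEPTH at a TAME pole prime — no lattice-tameness input -/

/-- **[ED] at a tame pole prime of a rational point.** `λ ∈ ℚ`, `T` a genuine Θ-volume datum over `(ratPoint λ, l)`, `p ∉ {2, 3, 5, l}` a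
prime at which `j(λ)` has a pole of order `≥ h ≥ 1`, a natural `k` with `p·(60·l) < p^{k+1}·(p−1)` (the tame `b`-window of abc-iut-S-d1's
budget for every `e ∣ 60·l`), and a label `i₀ + 1 ≤ l⋆` passing the integer test `2l·((i₀+2)((p−2)(k+1)+1) + (p−2)) < h·i₀(i₀+2)·(p−2)`
(⟺ `(i₀+2)(1 + 1/(p−2) + k) + 1 < (h/2l)·((i₀+1)²−1)`). THEN for every choice of the free context binders and Kummer datum the hull-level
clause S_H (chosen realising ideles, pinned reading) FAILS: every `x₀ | p` is tame with `e ∣ 60·l` (abc-iut-W-neg-1 p459442), so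
`d + a + b < 1 + 1/(p−2) + k` (abc-iut-S-d1 p455792), `‖t_q(x₀)‖ ≤ p^{−h/(2l)}` (abc-iut-w4-d026), and abc-iut-C-cert-1's explicit-depth decider
fires at the label `i₀`. No hypothesis `e ≤ p − 2`. [cite: Mochizuki2012, IUTchIV Prop. 1.2 p. 10, Prop. 1.8 (vii) p. 20, Cor. 2.2 (ii) proof (P5) p. 46;
IUTchIII Cor. 3.12 Step (xi-f) p. 184] [claim: Mochizuki2012, status: disputed] -/
theorem not_pilotKummerCompatHull_chosen_ratPoint_of_explicitDepth {q : ℚ} {l : ℕ}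
    (T : Cor22.ThetaVolumeDatumAt (ratPoint q) l) (pp : Nat.Primes) (hp2 : (pp : ℕ) ≠ 2) (hp3 : (pp : ℕ) ≠ 3) (hp5 : (pp : ℕ) ≠ 5)
    (hpl : (pp : ℕ) ≠ l) (h : ℕ) (hh : 1 ≤ h)
    (hord : ∀ u : HeightOneSpectrum (𝓞 ℚ), Rat.HeightOneSpectrum.natGenerator u = (pp : ℕ) → ord ℚ u (Cor22.jInv q) ≤ -(h : ℤ))
    (k : ℕ) (hwin : (pp : ℕ) * (60 * l) < (pp : ℕ) ^ (k + 1) * ((pp : ℕ) - 1))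
    (i₀ : ℕ) (hil : i₀ + 1 ≤ (l - 1) / 2)
    (hcrit : 2 * l * ((i₀ + 2) * (((pp : ℕ) - 2) * (k + 1) + 1) + ((pp : ℕ) - 2)) < h * (i₀ * (i₀ + 2)) * ((pp : ℕ) - 2)) :
    letI := T.instFieldF; letI := T.instNumberFieldF; letI := T.instAlgebraF; letI := T.instFieldK
    letI := T.instNumberFieldK; letI := T.instAlgebraK; letI := T.instFieldFbar; letI := T.instAlgebraFbar
    letI := T.instAlgebraKFbar; letI := T.instIsElliptic
    ∀ (M : Type) [Field M] [NumberField M]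
      (archPk : ∀ (j : (thetaIndex (pilotDataOfK T.D T.K)).Label) (vQ : (thetaIndex (pilotDataOfK T.D T.K)).VQ),
        Set ((logShellsDH (pilotDataOfK T.D T.K) (analyticLogv T.K)).Packet j vQ))
      (archSub : ∀ (j : (thetaIndex (pilotDataOfK T.D T.K)).Label) (v : (thetaIndex (pilotDataOfK T.D T.K)).V),
        Set ((logShellsDH (pilotDataOfK T.D T.K) (analyticLogv T.K)).Packet j ((thetaIndex (pilotDataOfK T.D T.K)).over v)))
      (Ψ : ℤ → ∀ v : (thetaIndex (pilotDataOfK T.D T.K)).V, v ∈ (thetaIndex (pilotDataOfK T.D T.K)).Vbad →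
        Set ((logShellsDH (pilotDataOfK T.D T.K) (analyticLogv T.K)).StarPacket v))
      (act : ℤ → ∀ v : (thetaIndex (pilotDataOfK T.D T.K)).V, v ∈ (thetaIndex (pilotDataOfK T.D T.K)).Vbad →
        (logShellsDH (pilotDataOfK T.D T.K) (analyticLogv T.K)).StarPacket v →
          Module.End ℚ ((logShellsDH (pilotDataOfK T.D T.K) (analyticLogv T.K)).StarPacket v))
      (Mmod : ℤ → ∀ j : (thetaIndex (pilotDataOfK T.D T.K)).LabelStar, Set ((logShellsDH (pilotDataOfK T.D T.K) (analyticLogv T.K)).GlobalPacket j.1))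
      (region : ℤ → ∀ j : (thetaIndex (pilotDataOfK T.D T.K)).LabelStar, FinDivisor M → ∀ vQ : (thetaIndex (pilotDataOfK T.D T.K)).VQ,
        Set ((logShellsDH (pilotDataOfK T.D T.K) (analyticLogv T.K)).Packet j.1 vQ))
      (frobAdm : ℤ → ℤ → ∀ (j : (thetaIndex (pilotDataOfK T.D T.K)).Label) (vQ : (thetaIndex (pilotDataOfK T.D T.K)).VQ),
        Set ((logShellsDH (pilotDataOfK T.D T.K) (analyticLogv T.K)).Packet j vQ) → Prop)
      (frobLogvol : ℤ → ℤ → ∀ (j : (thetaIndex (pilotDataOfK T.D T.K)).Label) (vQ : (thetaIndex (pilotDataOfK T.D T.K)).VQ),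
        Set ((logShellsDH (pilotDataOfK T.D T.K) (analyticLogv T.K)).Packet j vQ) → ℝ)
      (frobΨ : ℤ → ℤ → ∀ v : (thetaIndex (pilotDataOfK T.D T.K)).V, v ∈ (thetaIndex (pilotDataOfK T.D T.K)).Vbad →
        Set ((logShellsDH (pilotDataOfK T.D T.K) (analyticLogv T.K)).StarPacket v))
      (frobMmod : ℤ → ℤ → ∀ j : (thetaIndex (pilotDataOfK T.D T.K)).LabelStar, Set ((logShellsDH (pilotDataOfK T.D T.K) (analyticLogv T.K)).GlobalPacket j.1))
      (unitImage : ℤ → ℤ → ℕ → ∀ (j : (thetaIndex (pilotDataOfK T.D T.K)).Label) (vQ : (thetaIndex (pilotDataOfK T.D T.K)).VQ),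
        Set ((logShellsDH (pilotDataOfK T.D T.K) (analyticLogv T.K)).Packet j vQ))
      (ballImage : ℤ → ℤ → ∀ (j : (thetaIndex (pilotDataOfK T.D T.K)).Label) (vQ : (thetaIndex (pilotDataOfK T.D T.K)).VQ),
        Set ((logShellsDH (pilotDataOfK T.D T.K) (analyticLogv T.K)).Packet j vQ))
      (thetaDiv : ℤ → ℤ → LgpDivisor M (thetaIndex (pilotDataOfK T.D T.K)).lstar)
      (n : ℤ) {HT : Type} {LogLink : HT → HT → Type} {IsFull : ∀ {s t : HT}, LogLink s t → Prop}
      (lat : LGPGaussianLogThetaLattice LogLink IsFull)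
      {Frd : Type} {IsoF : Frd → Frd → Type} {Ob : Frd → Type} {realify : Frd → Frd} {Strip : Type}
      {IsoS : Strip → Strip → Type} {Mv : ∀ v : (thetaIndex (pilotDataOfK T.D T.K)).V, v ∈ (thetaIndex (pilotDataOfK T.D T.K)).Vbad → Type}
      [∀ v h, Monoid (Mv v h)]
      (sig : GlobalLGPFrobenioidSignature (thetaIndex (pilotDataOfK T.D T.K)).lstar (thetaIndex (pilotDataOfK T.D T.K)).V
        (· ∈ (thetaIndex (pilotDataOfK T.D T.K)).Vbad) Frd IsoF Ob realify Strip IsoS Mv)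
      (split : SplittingMonoids Mv) {ObΔ : Type} {N : ∀ v : (thetaIndex (pilotDataOfK T.D T.K)).V, v ∈ (thetaIndex (pilotDataOfK T.D T.K)).Vbad → Type}
      [∀ v h, Monoid (N v h)] (qData : QPilotData ObΔ N)
      (qK : ∀ v : (thetaIndex (pilotDataOfK T.D T.K)).V, v ∈ (thetaIndex (pilotDataOfK T.D T.K)).Vbad →
        Set ((logShellsDH (pilotDataOfK T.D T.K) (analyticLogv T.K)).StarPacket v)),
      ¬ Cor312Vol.PilotKummerCompatHull
          (LatticeSituation.ofShells (logShellsDH (pilotDataOfK T.D T.K) (analyticLogv T.K)) M archPk archSub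
            (summandPiecesPr (pilotDataOfK T.D T.K) (logvAnalytic_analyticLogv (F := T.K))).Adm
            (summandPiecesPr (pilotDataOfK T.D T.K) (logvAnalytic_analyticLogv (F := T.K))).logvol Ψ act Mmod region frobAdm frobLogvol frobΨ
            frobMmod unitImage ballImage thetaDiv)
          (settingPrVolSharp (pilotDataOfK T.D T.K) (logvAnalytic_analyticLogv (F := T.K)) M archPk archSub Ψ act Mmod region n lat sig split qData
            (exists_realising_qIdeles_pilotDataOfK T.D).choose (exists_realising_thetaIdeles_pilotDataOfK T.D).choose
            (exists_realising_qIdeles_pilotDataOfK T.D).choose_spec.1 (exists_realising_qIdeles_pilotDataOfK T.D).choose_spec.2.1)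
          (fun _ => Cor312.Setting.qRegion
            (settingPrVolSharp (pilotDataOfK T.D T.K) (logvAnalytic_analyticLogv (F := T.K)) M archPk archSub Ψ act Mmod region n lat sig split qData
              (exists_realising_qIdeles_pilotDataOfK T.D).choose (exists_realising_thetaIdeles_pilotDataOfK T.D).choose
              (exists_realising_qIdeles_pilotDataOfK T.D).choose_spec.1 (exists_realising_qIdeles_pilotDataOfK T.D).choose_spec.2.1)) qK := by
  classical
  letI := T.instFieldF; letI := T.instNumberFieldF; letI := T.instAlgebraF; letI := T.instFieldK
  letI := T.instNumberFieldK; letI := T.instAlgebraK; letI := T.instFieldFbar; letI := T.instAlgebraFbar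
  letI := T.instAlgebraKFbar; letI := T.instIsElliptic
  haveI : Fact (pp : ℕ).Prime := ⟨pp.2⟩
  intro M _ _ archPk archSub Ψ act Mmod region frobAdm frobLogvol frobΨ frobMmod unitImage ballImage thetaDiv n HT LogLink IsFull lat
    Frd IsoF Ob realify Strip IsoS Mv _ sig split ObΔ N _ qData qK
  obtain ⟨v, hv⟩ := (thetaIndex (pilotDataOfK T.D T.K)).fibre_nonempty (.inr pp)
  -- the label `i₀ + 1 ≤ l⋆` as an index
  have hlstar : (thetaIndex (pilotDataOfK T.D T.K)).lstar = (l - 1) / 2 := by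
    show ((pilotDataOfK T.D T.K).l - 1) / 2 = (l - 1) / 2
    rw [pilotDataOfK_l]
  have hlt : i₀ < (thetaIndex (pilotDataOfK T.D T.K)).lstar := by rw [hlstar]; omega
  have hp2' : 2 < (pp : ℕ) := by
    have := pp.2.two_le
    omega
  have hl5 : 5 ≤ l := T.D.five_le_l
  -- the local type at `x₀ := ⟨v, hv⟩`: `e ∣ 60·l`, `p ∤ e` (abc-iut-W-neg-1)
  have hpole : ∀ u : HeightOneSpectrum (𝓞 ℚ), Rat.HeightOneSpectrum.natGenerator u = (pp : ℕ) → ord ℚ u (Cor22.jInv q) < 0 :=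
    fun u hu => lt_of_le_of_lt (hord u hu) (by omega)
  obtain ⟨hdvd, hndvd⟩ := GenuineK.absRamificationIdx_kOf_dvd_ratPoint T pp hp2 hp3 hp5 hpl hpole ⟨v, hv⟩
  have he60 : absRamificationIdx (pp : ℕ) (kOf (pilotDataOfK T.D T.K) pp.1 ⟨v, hv⟩) ≤ 60 * l :=
    Nat.le_of_dvd (by omega) hdvd
  -- the tame budget `d + a + b < 1 + 1/(p−2) + k` (abc-iut-S-d1)
  have hC := depthConstants_lt_of_not_dvd_of_le (pp : ℕ) (kOf (pilotDataOfK T.D T.K) pp.1 ⟨v, hv⟩) hp2' hndvd he60 hwin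
  -- `‖t_q(x₀)‖ ≤ p^{−h/(2l)}` (abc-iut-w4-d026)
  obtain ⟨-, hnorm⟩ := norm_chosenQIdele_le_rpow_of_ratPoint' T.D q T.j_eq T.isP5Choice pp ⟨v, hv⟩ hp2 hpl h hh hord
  have hp1 : (1 : ℝ) < ((pp : ℕ) : ℝ) := by exact_mod_cast pp.2.one_lt
  have hτ : ‖(exists_realising_qIdeles_pilotDataOfK T.D).choose pp ⟨v, hv⟩‖ ≤
      ((pp : ℕ) : ℝ) ^ (-((h : ℝ) / ((2 * l : ℕ) : ℝ))) := by
    have : (-(h : ℝ) / (2 * l)) = -((h : ℝ) / ((2 * l : ℕ) : ℝ)) := by push_cast; ring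
    rw [← this]
    exact hnorm
  -- the integer test in real form: `2l·((i₀+2)·C + 1) < h·(i₀(i₀+2))`, `C = 1 + 1/(p−2) + k`
  have hpR : (2 : ℝ) < ((pp : ℕ) : ℝ) := by exact_mod_cast hp2'
  have hp20 : (0 : ℝ) < ((pp : ℕ) : ℝ) - 2 := by linarith
  have hcritR : (((2 * l : ℕ)) : ℝ) * ((((i₀ : ℕ) : ℝ) + 2) * (1 + 1 / (((pp : ℕ) : ℝ) - 2) + k) + 1) <
      (h : ℝ) * ((i₀ : ℝ) * ((i₀ : ℝ) + 2)) := by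
    have hc : (((2 * l * ((i₀ + 2) * (((pp : ℕ) - 2) * (k + 1) + 1) + ((pp : ℕ) - 2)) : ℕ)) : ℝ) <
        ((h * (i₀ * (i₀ + 2)) * ((pp : ℕ) - 2) : ℕ) : ℝ) := by exact_mod_cast hcrit
    push_cast [Nat.cast_sub hp2'.le] at hc
    have key : (((2 * l : ℕ)) : ℝ) * ((((i₀ : ℕ) : ℝ) + 2) * (1 + 1 / (((pp : ℕ) : ℝ) - 2) + k) + 1) * (((pp : ℕ) : ℝ) - 2) <
        (h : ℝ) * ((i₀ : ℝ) * ((i₀ : ℝ) + 2)) * (((pp : ℕ) : ℝ) - 2) := by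
      have e1 : (((2 * l : ℕ)) : ℝ) * ((((i₀ : ℕ) : ℝ) + 2) * (1 + 1 / (((pp : ℕ) : ℝ) - 2) + k) + 1) * (((pp : ℕ) : ℝ) - 2) =
          2 * (l : ℝ) * (((i₀ : ℝ) + 2) * ((((pp : ℕ) : ℝ) - 2) * ((k : ℝ) + 1) + 1) + (((pp : ℕ) : ℝ) - 2)) := by
        field_simp
        push_cast
        ring
      rw [e1]
      linarith
    exact lt_of_mul_lt_mul_right key hp20.le
  have hdeep := Hex.core_ineq_dab_label (p := ((pp : ℕ) : ℝ)) (i := i₀) hp1 (by omega) hcritR hC.le (norm_nonneg _) hτ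
  exact GenuineK.not_pilotKummerCompatHull_chosen_of_explicit_depth T.D M archPk archSub Ψ act Mmod region frobAdm frobLogvol
    frobΨ frobMmod unitImage ballImage thetaDiv n lat sig split qData qK pp ⟨i₀, hlt⟩ ⟨v, hv⟩ hdeep

/-- **[ED] at a tame prime of an abc TRIPLE.** `a + b = c` coprime, `λ = a/c` (abc-iut-S6's Frey–Legendre point: `−ord_p j(a/c) ≥ 2·v_p(abc)`),
a prime `p ∉ {2, 3, 5, l}` with `p^v ∣ abc` (`v ≥ 1`), `p·(60·l) < p^{k+1}·(p−1)`, and a label `i₀ + 1 ≤ l⋆` with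
`l·((i₀+2)((p−2)(k+1)+1) + (p−2)) < v·i₀(i₀+2)·(p−2)` ⟹ ¬ S_H at every genuine Θ-volume datum over `(ratPoint (a/c), l)`, every choice of the
free binders. [cite: MochizukiGenEll2010, Thm. 2.1 p. 11] [cite: Mochizuki2012, IUTchIII Cor. 3.12 Step (xi-f) p. 184] [claim: Mochizuki2012, status: disputed] -/
theorem not_pilotKummerCompatHull_chosen_triple_of_explicitDepth {a b c : ℕ} (habc : IsABCTriple a b c) {l : ℕ}
    (T : Cor22.ThetaVolumeDatumAt (ratPoint ((a : ℚ) / c)) l) (pp : Nat.Primes) (hp2 : (pp : ℕ) ≠ 2) (hp3 : (pp : ℕ) ≠ 3)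
    (hp5 : (pp : ℕ) ≠ 5) (hpl : (pp : ℕ) ≠ l) (v : ℕ) (hv : 1 ≤ v) (hdvd : (pp : ℕ) ^ v ∣ a * b * c)
    (k : ℕ) (hwin : (pp : ℕ) * (60 * l) < (pp : ℕ) ^ (k + 1) * ((pp : ℕ) - 1))
    (i₀ : ℕ) (hil : i₀ + 1 ≤ (l - 1) / 2)
    (hcrit : l * ((i₀ + 2) * (((pp : ℕ) - 2) * (k + 1) + 1) + ((pp : ℕ) - 2)) < v * (i₀ * (i₀ + 2)) * ((pp : ℕ) - 2)) :
    letI := T.instFieldF; letI := T.instNumberFieldF; letI := T.instAlgebraF; letI := T.instFieldK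
    letI := T.instNumberFieldK; letI := T.instAlgebraK; letI := T.instFieldFbar; letI := T.instAlgebraFbar
    letI := T.instAlgebraKFbar; letI := T.instIsElliptic
    ∀ (M : Type) [Field M] [NumberField M]
      (archPk : ∀ (j : (thetaIndex (pilotDataOfK T.D T.K)).Label) (vQ : (thetaIndex (pilotDataOfK T.D T.K)).VQ),
        Set ((logShellsDH (pilotDataOfK T.D T.K) (analyticLogv T.K)).Packet j vQ))
      (archSub : ∀ (j : (thetaIndex (pilotDataOfK T.D T.K)).Label) (v : (thetaIndex (pilotDataOfK T.D T.K)).V),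
        Set ((logShellsDH (pilotDataOfK T.D T.K) (analyticLogv T.K)).Packet j ((thetaIndex (pilotDataOfK T.D T.K)).over v)))
      (Ψ : ℤ → ∀ v : (thetaIndex (pilotDataOfK T.D T.K)).V, v ∈ (thetaIndex (pilotDataOfK T.D T.K)).Vbad →
        Set ((logShellsDH (pilotDataOfK T.D T.K) (analyticLogv T.K)).StarPacket v))
      (act : ℤ → ∀ v : (thetaIndex (pilotDataOfK T.D T.K)).V, v ∈ (thetaIndex (pilotDataOfK T.D T.K)).Vbad →
        (logShellsDH (pilotDataOfK T.D T.K) (analyticLogv T.K)).StarPacket v →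
          Module.End ℚ ((logShellsDH (pilotDataOfK T.D T.K) (analyticLogv T.K)).StarPacket v))
      (Mmod : ℤ → ∀ j : (thetaIndex (pilotDataOfK T.D T.K)).LabelStar, Set ((logShellsDH (pilotDataOfK T.D T.K) (analyticLogv T.K)).GlobalPacket j.1))
      (region : ℤ → ∀ j : (thetaIndex (pilotDataOfK T.D T.K)).LabelStar, FinDivisor M → ∀ vQ : (thetaIndex (pilotDataOfK T.D T.K)).VQ,
        Set ((logShellsDH (pilotDataOfK T.D T.K) (analyticLogv T.K)).Packet j.1 vQ))
      (frobAdm : ℤ → ℤ → ∀ (j : (thetaIndex (pilotDataOfK T.D T.K)).Label) (vQ : (thetaIndex (pilotDataOfK T.D T.K)).VQ),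
        Set ((logShellsDH (pilotDataOfK T.D T.K) (analyticLogv T.K)).Packet j vQ) → Prop)
      (frobLogvol : ℤ → ℤ → ∀ (j : (thetaIndex (pilotDataOfK T.D T.K)).Label) (vQ : (thetaIndex (pilotDataOfK T.D T.K)).VQ),
        Set ((logShellsDH (pilotDataOfK T.D T.K) (analyticLogv T.K)).Packet j vQ) → ℝ)
      (frobΨ : ℤ → ℤ → ∀ v : (thetaIndex (pilotDataOfK T.D T.K)).V, v ∈ (thetaIndex (pilotDataOfK T.D T.K)).Vbad →
        Set ((logShellsDH (pilotDataOfK T.D T.K) (analyticLogv T.K)).StarPacket v))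
      (frobMmod : ℤ → ℤ → ∀ j : (thetaIndex (pilotDataOfK T.D T.K)).LabelStar, Set ((logShellsDH (pilotDataOfK T.D T.K) (analyticLogv T.K)).GlobalPacket j.1))
      (unitImage : ℤ → ℤ → ℕ → ∀ (j : (thetaIndex (pilotDataOfK T.D T.K)).Label) (vQ : (thetaIndex (pilotDataOfK T.D T.K)).VQ),
        Set ((logShellsDH (pilotDataOfK T.D T.K) (analyticLogv T.K)).Packet j vQ))
      (ballImage : ℤ → ℤ → ∀ (j : (thetaIndex (pilotDataOfK T.D T.K)).Label) (vQ : (thetaIndex (pilotDataOfK T.D T.K)).VQ),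
        Set ((logShellsDH (pilotDataOfK T.D T.K) (analyticLogv T.K)).Packet j vQ))
      (thetaDiv : ℤ → ℤ → LgpDivisor M (thetaIndex (pilotDataOfK T.D T.K)).lstar)
      (n : ℤ) {HT : Type} {LogLink : HT → HT → Type} {IsFull : ∀ {s t : HT}, LogLink s t → Prop}
      (lat : LGPGaussianLogThetaLattice LogLink IsFull)
      {Frd : Type} {IsoF : Frd → Frd → Type} {Ob : Frd → Type} {realify : Frd → Frd} {Strip : Type}
      {IsoS : Strip → Strip → Type} {Mv : ∀ v : (thetaIndex (pilotDataOfK T.D T.K)).V, v ∈ (thetaIndex (pilotDataOfK T.D T.K)).Vbad → Type}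
      [∀ v h, Monoid (Mv v h)]
      (sig : GlobalLGPFrobenioidSignature (thetaIndex (pilotDataOfK T.D T.K)).lstar (thetaIndex (pilotDataOfK T.D T.K)).V
        (· ∈ (thetaIndex (pilotDataOfK T.D T.K)).Vbad) Frd IsoF Ob realify Strip IsoS Mv)
      (split : SplittingMonoids Mv) {ObΔ : Type} {N : ∀ v : (thetaIndex (pilotDataOfK T.D T.K)).V, v ∈ (thetaIndex (pilotDataOfK T.D T.K)).Vbad → Type}
      [∀ v h, Monoid (N v h)] (qData : QPilotData ObΔ N)
      (qK : ∀ v : (thetaIndex (pilotDataOfK T.D T.K)).V, v ∈ (thetaIndex (pilotDataOfK T.D T.K)).Vbad →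
        Set ((logShellsDH (pilotDataOfK T.D T.K) (analyticLogv T.K)).StarPacket v)),
      ¬ Cor312Vol.PilotKummerCompatHull
          (LatticeSituation.ofShells (logShellsDH (pilotDataOfK T.D T.K) (analyticLogv T.K)) M archPk archSub
            (summandPiecesPr (pilotDataOfK T.D T.K) (logvAnalytic_analyticLogv (F := T.K))).Adm
            (summandPiecesPr (pilotDataOfK T.D T.K) (logvAnalytic_analyticLogv (F := T.K))).logvol Ψ act Mmod region frobAdm frobLogvol frobΨ
            frobMmod unitImage ballImage thetaDiv)
          (settingPrVolSharp (pilotDataOfK T.D T.K) (logvAnalytic_analyticLogv (F := T.K)) M archPk archSub Ψ act Mmod region n lat sig split qData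
            (exists_realising_qIdeles_pilotDataOfK T.D).choose (exists_realising_thetaIdeles_pilotDataOfK T.D).choose
            (exists_realising_qIdeles_pilotDataOfK T.D).choose_spec.1 (exists_realising_qIdeles_pilotDataOfK T.D).choose_spec.2.1)
          (fun _ => Cor312.Setting.qRegion
            (settingPrVolSharp (pilotDataOfK T.D T.K) (logvAnalytic_analyticLogv (F := T.K)) M archPk archSub Ψ act Mmod region n lat sig split qData
              (exists_realising_qIdeles_pilotDataOfK T.D).choose (exists_realising_thetaIdeles_pilotDataOfK T.D).choose
              (exists_realising_qIdeles_pilotDataOfK T.D).choose_spec.1 (exists_realising_qIdeles_pilotDataOfK T.D).choose_spec.2.1)) qK := by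
  -- the pole order of `j(a/c)` at `p` is `≥ 2·v_p(abc) ≥ 2v` (verbatim the step of abc-iut-w5-d107's `…_triple_of_sixty`)
  have habc0 : a * b * c ≠ 0 := by
    obtain ⟨ha, hb, hsum, -⟩ := habc
    exact Nat.mul_ne_zero (Nat.mul_ne_zero ha.ne' hb.ne') (by omega)
  have hvle : v ≤ (a * b * c).factorization (pp : ℕ) := (pp.2.pow_dvd_iff_le_factorization habc0).1 hdvd
  have hord : ∀ u : HeightOneSpectrum (𝓞 ℚ), Rat.HeightOneSpectrum.natGenerator u = (pp : ℕ) →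
      ord ℚ u (Cor22.jInv ((a : ℚ) / c)) ≤ -((2 * v : ℕ) : ℤ) := by
    intro u hu
    have hdvd1 : Rat.HeightOneSpectrum.natGenerator u ∣ a * b * c := by
      rw [hu]; exact (dvd_pow_self _ (by omega)).trans hdvd
    have h2 := Cor22.neg_ord_jInv_ratPoint_triple habc u (by rw [hu]; exact hp2) hdvd1
    rw [hu] at h2
    push_cast at h2 ⊢
    have : (v : ℤ) ≤ ((a * b * c).factorization (pp : ℕ) : ℤ) := by exact_mod_cast hvle
    linarith
  exact not_pilotKummerCompatHull_chosen_ratPoint_of_explicitDepth T pp hp2 hp3 hp5 hpl (2 * v) (by omega) hord k hwin i₀ hil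
    (by
      have : 2 * l * ((i₀ + 2) * (((pp : ℕ) - 2) * (k + 1) + 1) + ((pp : ℕ) - 2)) =
          2 * (l * ((i₀ + 2) * (((pp : ℕ) - 2) * (k + 1) + 1) + ((pp : ℕ) - 2))) := by ring
      rw [this]
      have : 2 * v * (i₀ * (i₀ + 2)) * ((pp : ℕ) - 2) = 2 * (v * (i₀ * (i₀ + 2)) * ((pp : ℕ) - 2)) := by ring
      rw [this]
      omega)


end FreyRef

end Summit.ABC.IUTFork.Conditional

end
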